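import Summits.QuantumFields.BalabanUV.T4Continuum.Spine.NE2BalabanThreshold
import Literature.MathematicalPhysics.QuantumFieldTheory.Balaban1983to89.B7Prop1Explicit

/-!
# T⁴ programme, spine node NE2 (U1a), tier B rows B5 × B6 × B7 — NON-FLAT WITNESSES FOR ROOT B's END:
# the constant exponential backgrounds `R^{(k)}_ν ≡ exp((θ/n_k)·A_ν)` (colour matrices `A_ν`, `‖A_ν‖ ≤ 1`) lie in row B5's class, satisfy node NE3's
# hypothesis SHAPE with rate `L^{−k}`, and for `|θ| + θ² ≤ η⋆` ROOT B's END fires for them with no hypothesis left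

NE2 formalisation swarm `b2b-balaban-t4-ne2-formalise-*`, leaf prover 03 (row B5 lineage; leaf-proposed support row «B7.w END WITNESS», INTENT
CLAIMS.log l.8648 ∕ l.8890, second file).  ROOT B's END of record, `Spine/NE2BalabanThreshold.balaban_final_rate_of_regular` (leaf-08, p212305),
displays `hreg : RegularTransporters L M (liftR L M Rg) α β`, `hNE3 : LocalRate (bgReadings L M (regClass L M (liftR L M Rg))) C L⁻¹` (node NE3 BY NAME,
OPEN), `0 < a′`, `α ≤ η`, `β ≤ η`, `η ≤ η⋆`.  `Spine/NE2BalabanFlatWitness` (p212801) discharges them at the FLAT background, where the typed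
perturbation vanishes.  This file exhibits a FAMILY OF NON-FLAT backgrounds on which they are discharged too: for colour matrices
`A : Fin d → Matrix o o ℂ` with `‖A_ν‖ ≤ 1` and a real amplitude `θ`, the constant exponential background
`constRg A θ : R^{(k)}_ν(x) = exp((θ/n_k)·A_ν)` (`n_k = L^k`) — covering the abelian phases `A_ν = i·1` and NON-COMMUTING generators `A_μ, A_ν`
alike (for skew-adjoint `A_ν` the transporters are unitary, `constRg_mem_unitary`):
 * §1 the exponent `xlev θ A k = (θ/n_k)·A`, the transporter `uexp = exp xlev` and the connection reading `wexp θ A k = n_k·(exp((θ/n_k)A) − 1)`: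
   **`norm_wexp_sub_le`** `‖w_k − θ·A‖ ≤ θ²/n_k` (`|θ| ≤ 1`, `‖A‖ ≤ 1`; the tree's `norm_exp_sub_one_le_of_norm_le` + `expRem_le_sq`), `norm_wexp_le`
   `‖w_k‖ ≤ |θ| + θ²`, **`norm_wexp_succ_sub_le`** `‖w_{k+1} − w_k‖ ≤ 2θ²/n_k`, `wexp_ne_zero` (`0 < |θ| < 1`, `A ≠ 0` ⟹ `w_k ≠ 0`);
 * §2 **`regularTransporters_const`**: `RegularTransporters L M (liftR L M (constRg A θ)) (|θ| + θ²) 0` — row B5's (3.35)-shape class is populated by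
   non-flat (and non-abelian) data; `connTower_const` (`w^{(k)}_ν = w_k(θ, A_ν)`, definitional), `dconnTower_const` (`= 0`: constant in `x`),
   `constRg_ne_one` (the transporters differ from the identity when `A_ν ≠ 0`, `0 < |θ| < 1`), `constRg_mem_unitary`;
 * §3 **`localRate_const`**: node NE3's hypothesis SHAPE `LocalRate (bgReadings (regClass (liftR (constRg A θ)))) (2θ²) L⁻¹` HOLDS on this family,
   through the owner's faithful adapter `NE2FromNE3.localRate_of_consistent` — the two-level consistency `‖w_{k+1} − w_k‖ ≤ 2θ²/n_k` is EXACTLY the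
   socket's currency; a statement about the SHAPE on this toy family ONLY, not about node NE3 for Bałaban's minimisers;
 * §4 **`balaban_final_rate_const (hL) (hd) (ha′) (hA) (hθ : |θ| + θ² ≤ etaStar o d a a′)`**: ROOT B's END for `Rg := constRg A θ` with every other
   binder DISCHARGED, and **`balaban_final_rate_const_half`**: the unconditional instance at `θ = η⋆/2` (`> 0` by `etaStar_pos`; non-flat for
   `A_ν ≠ 0` by `constRg_half_ne_one`).

HONEST FRAMING (T4-DAG p. 1).  TOY members of the data class (constant exponential backgrounds; OURS), finite-dimensional algebra and the
exponential's second-order remainder; asserts NOTHING about Bałaban's minimisers `U_k(V)` (no B0, c5) and nothing about node NE3 away from this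
family; ROOT B for general data stays CONDITIONAL on node NE3 (OPEN) and on row B5's class; GLOBAL small field; finite torus, linear layer,
operator norm; NOT [B9] (3.23)–(3.26) as printed; NE2 (U1a) is NOT PROVED by this file (c1 with the carver); spine PROVED 0/9 unchanged; NOT
infinite volume, NOT a mass gap, NOT Clay, NOT summit progress.  HONEST DEPENDENCY: continuum YM on T⁴ ⇐ BetaPertH ∧ nine spine estimates (0/9
proved); BetaPertH ⇐ (D1) ∧ (D4) ∧ CAP+tail; G-an2-4 gates asym, D1 and NE2/3/4.  ABSOLUTE RULE: no internally-minted statement enters as a cited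
fact; no `[cite:]` tag is used as a fact; no `def … : Prop` fact; no `sorry`.
-/

noncomputable section

open scoped BigOperators ComplexConjugate Matrix Matrix.Norms.L2Operator Kronecker
open Filter Topology NormedSpace

namespace Summit.QuantumFields.BalabanUV.T4Continuum.NE2BalabanConstWitness

open Literature.MathematicalPhysics.QuantumFieldTheory.Balaban1983to89.B5Prop11Plancherel (Cst Cst_nonneg Tor fine)
open Literature.MathematicalPhysics.QuantumFieldTheory.Balaban1983to89.B5G183RateUnitTower (lev lev_neZero)
open Literature.MathematicalPhysics.QuantumFieldTheory.Balaban1983to89.B7Prop1Explicit (norm_exp_sub_one_le_of_norm_le expRem_le_sq)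
open Literature.MathematicalPhysics.QuantumFieldTheory.Balaban1983to89.T4EtaRateMin (LocalRate)
open Summit.QuantumFields.BalabanUV.T4Continuum
open Summit.QuantumFields.BalabanUV.T4Continuum.CovariantAveragingTower (TowerLimitRate)
open Summit.QuantumFields.BalabanUV.T4Continuum.BalabanAveragedTowerUnit (idx Qlev one_le_lev' lev_succ' cast_lev')
open Summit.QuantumFields.BalabanUV.T4Continuum.BackgroundResolventTower
open Summit.QuantumFields.BalabanUV.T4Continuum.BackgroundResolventLaw (l2_opNorm_one_le)
open Summit.QuantumFields.BalabanUV.T4Continuum.BlockPairingGeometry (parT)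
open Summit.QuantumFields.BalabanUV.T4Continuum.KingPairingPlantedLaw
open Summit.QuantumFields.BalabanUV.T4Continuum.GramPerturbationLaw (C2gram)
open Summit.QuantumFields.BalabanUV.T4Continuum.NE2FromNE3 (bgReadings localRate_of_consistent)
open Summit.QuantumFields.BalabanUV.T4Continuum.RegularBackgroundTower (RegularTransporters connTower dconnTower regClass betaNE3 lev_pos)
open Summit.QuantumFields.BalabanUV.T4Continuum.GaugeTermScalarData (QuT Q1)
open Summit.QuantumFields.BalabanUV.T4Continuum.GaugeTermThreshold (KB4 KS_nonneg K_nonneg)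
open Summit.QuantumFields.BalabanUV.T4Continuum.RegularSiteTransporters (siteT)
open Summit.QuantumFields.BalabanUV.T4Continuum.NestedContourTransport (theta0)
open Summit.QuantumFields.BalabanUV.T4Continuum.NE2BalabanRoot (balabanPert)
open Summit.QuantumFields.BalabanUV.T4Continuum.NE2BalabanGauge (gaugeSlot liftR)
open Summit.QuantumFields.BalabanUV.T4Continuum.NE2BalabanLayerSharp (kappaBs C2Bs KstarR)
open Summit.QuantumFields.BalabanUV.T4Continuum.NE2BalabanWiring (epsR CdeltaR)
open Summit.QuantumFields.BalabanUV.T4Continuum.NE2BalabanFinal (kappa4F C4F)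
open Summit.QuantumFields.BalabanUV.T4Continuum.NE2BalabanThreshold (etaStar etaStar_pos balaban_final_rate_of_regular)

/-! ## §1 The exponent, the transporter, the connection reading and their arithmetic -/

section Arith

variable (L : ℕ) {o : Type*} [Fintype o] [DecidableEq o]

/-- the exponent `X_k(θ, A) = (θ/n_k)·A` at level `k` (`n_k = L^k`). [folklore] -/
def xlev (θ : ℝ) (A : Matrix o o ℂ) (k : ℕ) : Matrix o o ℂ := ((θ / (lev L k : ℕ) : ℝ) : ℂ) • A

/-- the transporter `u_k(θ, A) = exp((θ/n_k)·A)`. [folklore] -/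
def uexp (θ : ℝ) (A : Matrix o o ℂ) (k : ℕ) : Matrix o o ℂ := exp (xlev L θ A k)

/-- the connection reading `w_k(θ, A) = n_k·(exp((θ/n_k)·A) − 1)` (`→ θ·A`). [folklore] -/
def wexp (θ : ℝ) (A : Matrix o o ℂ) (k : ℕ) : Matrix o o ℂ := ((lev L k : ℕ) : ℂ) • (uexp L θ A k - 1)

variable [NeZero L]

omit [Fintype o] [DecidableEq o] in
/-- `1 ≤ n_k` in `ℝ`. [folklore] -/
theorem one_le_cast_lev (k : ℕ) : (1 : ℝ) ≤ ((lev L k : ℕ) : ℝ) := by exact_mod_cast one_le_lev' L k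

/-- `‖X_k‖ ≤ |θ|/n_k ≤ 1` for `|θ| ≤ 1`, `‖A‖ ≤ 1`. [folklore] -/
theorem norm_xlev_le {θ : ℝ} (hθ : |θ| ≤ 1) {A : Matrix o o ℂ} (hA : ‖A‖ ≤ 1) (k : ℕ) :
    ‖xlev L θ A k‖ ≤ |θ| / ((lev L k : ℕ) : ℝ) ∧ ‖xlev L θ A k‖ ≤ 1 := by
  have hn1 := one_le_cast_lev L k
  have hn0 : (0 : ℝ) < ((lev L k : ℕ) : ℝ) := by linarith
  have h1 : ‖xlev L θ A k‖ ≤ |θ| / ((lev L k : ℕ) : ℝ) := by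
    rw [xlev, norm_smul, Complex.norm_real, Real.norm_eq_abs, abs_div, abs_of_pos hn0]
    exact mul_le_of_le_one_right (by positivity) hA
  exact ⟨h1, h1.trans ((div_le_one hn0).mpr (hθ.trans hn1))⟩

/-- the algebra of the remainder: `w_k − θ·A = n_k·(e^{X_k} − 1 − X_k)` (since `n_k·X_k = θ·A`). [folklore] -/
theorem wexp_sub_eq (θ : ℝ) (A : Matrix o o ℂ) (k : ℕ) :
    wexp L θ A k - (θ : ℂ) • A = (((lev L k : ℕ) : ℝ) : ℂ) • (exp (xlev L θ A k) - 1 - xlev L θ A k) := by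
  have hn0 : (0 : ℝ) < ((lev L k : ℕ) : ℝ) := by linarith [one_le_cast_lev L k]
  have hnθ : ((lev L k : ℕ) : ℝ) * (θ / (lev L k : ℕ)) = θ := by field_simp
  have hnx : (((lev L k : ℕ) : ℝ) : ℂ) • xlev L θ A k = (θ : ℂ) • A := by
    rw [xlev, smul_smul, ← Complex.ofReal_mul, hnθ]
  rw [← hnx, wexp, uexp, Complex.ofReal_natCast]
  simp only [smul_sub]

/-- the SHARP second-order remainder `‖w_k − θ·A‖ ≤ θ²‖A‖²/n_k` for `|θ| ≤ 1`, `‖A‖ ≤ 1` (the tree's `norm_exp_sub_one_le_of_norm_le` and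
`expRem_le_sq`). [folklore] -/
theorem norm_wexp_sub_le_sharp {θ : ℝ} (hθ : |θ| ≤ 1) {A : Matrix o o ℂ} (hA : ‖A‖ ≤ 1) (k : ℕ) :
    ‖wexp L θ A k - (θ : ℂ) • A‖ ≤ (|θ| * ‖A‖) ^ 2 / ((lev L k : ℕ) : ℝ) := by
  have hn1 := one_le_cast_lev L k
  have hn0 : (0 : ℝ) < ((lev L k : ℕ) : ℝ) := by linarith
  obtain ⟨-, hX1⟩ := norm_xlev_le L hθ hA k
  have hrem : ‖exp (xlev L θ A k) - 1 - xlev L θ A k‖ ≤ ‖xlev L θ A k‖ ^ 2 :=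
    (norm_exp_sub_one_le_of_norm_le le_rfl).2.trans (expRem_le_sq (norm_nonneg _) hX1)
  have hXeq : ‖xlev L θ A k‖ = |θ| * ‖A‖ / ((lev L k : ℕ) : ℝ) := by
    rw [xlev, norm_smul, Complex.norm_real, Real.norm_eq_abs, abs_div, abs_of_pos hn0]; ring
  rw [wexp_sub_eq, norm_smul, Complex.norm_real, Real.norm_of_nonneg hn0.le]
  calc ((lev L k : ℕ) : ℝ) * ‖exp (xlev L θ A k) - 1 - xlev L θ A k‖
      ≤ ((lev L k : ℕ) : ℝ) * (|θ| * ‖A‖ / ((lev L k : ℕ) : ℝ)) ^ 2 :=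
        mul_le_mul_of_nonneg_left (hrem.trans (le_of_eq (by rw [hXeq]))) hn0.le
    _ = (|θ| * ‖A‖) ^ 2 / ((lev L k : ℕ) : ℝ) := by rw [div_pow]; field_simp

/-- **`‖w_k − θ·A‖ ≤ θ²/n_k`** for `|θ| ≤ 1`, `‖A‖ ≤ 1`. [folklore] -/
theorem norm_wexp_sub_le {θ : ℝ} (hθ : |θ| ≤ 1) {A : Matrix o o ℂ} (hA : ‖A‖ ≤ 1) (k : ℕ) :
    ‖wexp L θ A k - (θ : ℂ) • A‖ ≤ θ ^ 2 / ((lev L k : ℕ) : ℝ) := by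
  have hn0 : (0 : ℝ) < ((lev L k : ℕ) : ℝ) := by linarith [one_le_cast_lev L k]
  refine (norm_wexp_sub_le_sharp L hθ hA k).trans (div_le_div_of_nonneg_right ?_ hn0.le)
  have h1 : |θ| * ‖A‖ ≤ |θ| := mul_le_of_le_one_right (abs_nonneg θ) hA
  have h0 : 0 ≤ |θ| * ‖A‖ := mul_nonneg (abs_nonneg θ) (norm_nonneg A)
  calc (|θ| * ‖A‖) ^ 2 ≤ |θ| ^ 2 := pow_le_pow_left₀ h0 h1 2
    _ = θ ^ 2 := sq_abs θ

/-- **`‖w_k‖ ≤ |θ| + θ²`** (the size of the class member). [folklore] -/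
theorem norm_wexp_le {θ : ℝ} (hθ : |θ| ≤ 1) {A : Matrix o o ℂ} (hA : ‖A‖ ≤ 1) (k : ℕ) : ‖wexp L θ A k‖ ≤ |θ| + θ ^ 2 := by
  have h1 := norm_wexp_sub_le L hθ hA k
  have h2 : θ ^ 2 / ((lev L k : ℕ) : ℝ) ≤ θ ^ 2 := div_le_self (sq_nonneg θ) (one_le_cast_lev L k)
  have h3 : ‖(θ : ℂ) • A‖ ≤ |θ| := by
    rw [norm_smul, Complex.norm_real, Real.norm_eq_abs]; exact mul_le_of_le_one_right (abs_nonneg θ) hA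
  calc ‖wexp L θ A k‖ = ‖(wexp L θ A k - (θ : ℂ) • A) + (θ : ℂ) • A‖ := by rw [sub_add_cancel]
    _ ≤ ‖wexp L θ A k - (θ : ℂ) • A‖ + ‖(θ : ℂ) • A‖ := norm_add_le _ _
    _ ≤ θ ^ 2 + |θ| := add_le_add (h1.trans h2) h3
    _ = |θ| + θ ^ 2 := add_comm _ _

/-- **THE TWO-LEVEL CONSISTENCY OF THE READING**: `‖w_{k+1} − w_k‖ ≤ 2θ²/n_k` (`|θ| ≤ 1`, `‖A‖ ≤ 1`). [folklore] -/
theorem norm_wexp_succ_sub_le {θ : ℝ} (hθ : |θ| ≤ 1) {A : Matrix o o ℂ} (hA : ‖A‖ ≤ 1) (k : ℕ) :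
    ‖wexp L θ A (k + 1) - wexp L θ A k‖ ≤ 2 * θ ^ 2 / ((lev L k : ℕ) : ℝ) := by
  have hn1 := one_le_cast_lev L k
  have hn0 : (0 : ℝ) < ((lev L k : ℕ) : ℝ) := by linarith
  have hL1 : (1 : ℝ) ≤ L := by exact_mod_cast Nat.one_le_iff_ne_zero.mpr (NeZero.ne L)
  have h1 := norm_wexp_sub_le L hθ hA (k + 1)
  have h0 := norm_wexp_sub_le L hθ hA k
  have hmono : ((lev L k : ℕ) : ℝ) ≤ ((lev L (k + 1) : ℕ) : ℝ) := by
    rw [lev_succ', Nat.cast_mul]; exact le_mul_of_one_le_left hn0.le hL1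
  have hk1 : θ ^ 2 / ((lev L (k + 1) : ℕ) : ℝ) ≤ θ ^ 2 / ((lev L k : ℕ) : ℝ) :=
    div_le_div_of_nonneg_left (sq_nonneg θ) hn0 hmono
  calc ‖wexp L θ A (k + 1) - wexp L θ A k‖
      = ‖(wexp L θ A (k + 1) - (θ : ℂ) • A) - (wexp L θ A k - (θ : ℂ) • A)‖ := by rw [sub_sub_sub_cancel_right]
    _ ≤ ‖wexp L θ A (k + 1) - (θ : ℂ) • A‖ + ‖wexp L θ A k - (θ : ℂ) • A‖ := norm_sub_le _ _
    _ ≤ θ ^ 2 / ((lev L k : ℕ) : ℝ) + θ ^ 2 / ((lev L k : ℕ) : ℝ) := add_le_add (h1.trans hk1) h0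
    _ = 2 * θ ^ 2 / ((lev L k : ℕ) : ℝ) := by ring

/-- **THE WITNESS IS NOT FLAT**: `w_k ≠ 0` for `0 < |θ| < 1`, `A ≠ 0`, `‖A‖ ≤ 1` (else `|θ|‖A‖ = ‖θ·A‖ ≤ θ²‖A‖²`, i.e. `1 ≤ |θ|‖A‖ < 1`).
[folklore] -/
theorem wexp_ne_zero {θ : ℝ} (h0 : θ ≠ 0) (h1 : |θ| < 1) {A : Matrix o o ℂ} (hA0 : A ≠ 0) (hA : ‖A‖ ≤ 1) (k : ℕ) :
    wexp L θ A k ≠ 0 := by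
  intro h
  have hb := norm_wexp_sub_le_sharp L h1.le hA k
  rw [h, zero_sub, norm_neg, norm_smul, Complex.norm_real, Real.norm_eq_abs] at hb
  have hp : 0 < |θ| * ‖A‖ := mul_pos (abs_pos.mpr h0) (norm_pos_iff.mpr hA0)
  have hb' : |θ| * ‖A‖ ≤ (|θ| * ‖A‖) * (|θ| * ‖A‖) := by
    rw [← sq]; exact hb.trans (div_le_self (sq_nonneg _) (one_le_cast_lev L k))
  have h5 : 1 ≤ |θ| * ‖A‖ := le_of_mul_le_mul_right (by linarith [hb']) hp
  have h6 : |θ| * ‖A‖ < 1 := by nlinarith [norm_nonneg A, abs_nonneg θ]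
  linarith

end Arith

/-! ## §2 The constant exponential backgrounds lie in row B5's class -/

/-- **THE CONSTANT EXPONENTIAL BACKGROUND** `R^{(k)}_ν(x) = exp((θ/n_k)·A_ν)` for colour matrices `A : Fin d → Matrix o o ℂ` (site-based bond
transporters; TOY members of the data class, OURS — no relation to Bałaban's minimisers is asserted). [folklore] -/
def constRg {d : ℕ} (L : ℕ) (M : Fin d → ℕ) {o : Type*} [Fintype o] [DecidableEq o] (A : Fin d → Matrix o o ℂ) (θ : ℝ) :
    (k : ℕ) → Fin d → (Tor (fine (lev L k) M) → Matrix o o ℂ) :=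
  fun k ν _ => uexp L θ (A ν) k

variable {d : ℕ} (L : ℕ) [NeZero L] (M : Fin d → ℕ) [hM : ∀ μ, NeZero (M μ)] (a : ℝ) (ha : 0 < a)
variable {o : Type*} [Fintype o] [DecidableEq o]

omit [NeZero L] hM in
/-- the connection tower of the constant background IS the reading `w_k(θ, A_ν)` (definitional). [folklore] -/
theorem connTower_const (A : Fin d → Matrix o o ℂ) (θ : ℝ) (k : ℕ) (ν : Fin d) (i : idx L M k) :
    connTower L M (liftR L M (constRg L M A θ)) k ν i = wexp L θ (A ν) k := rfl

omit [NeZero L] hM in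
/-- the lattice-derivative tower of the constant background vanishes. [folklore] -/
theorem dconnTower_const (A : Fin d → Matrix o o ℂ) (θ : ℝ) (k : ℕ) (ν : Fin d) (i : idx L M k) :
    dconnTower L M (liftR L M (constRg L M A θ)) k ν i = 0 := by
  rw [dconnTower, connTower_const, connTower_const, sub_self, smul_zero]

omit hM in
/-- **ROW B5's CLASS IS POPULATED BY NON-FLAT, NON-ABELIAN DATA**: for `|θ| ≤ 1` and `‖A_ν‖ ≤ 1` the constant exponential background lies in
the (3.35)-shape class with sizes `α = |θ| + θ²`, `β = 0`. [folklore] -/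
theorem regularTransporters_const {A : Fin d → Matrix o o ℂ} (hA : ∀ ν, ‖A ν‖ ≤ 1) {θ : ℝ} (hθ : |θ| ≤ 1) :
    RegularTransporters L M (liftR L M (constRg L M A θ)) (|θ| + θ ^ 2) 0 where
  nonneg := ⟨by positivity, le_rfl⟩
  size k ν i := by
    show ‖wexp L θ (A ν) k‖ ≤ |θ| + θ ^ 2
    exact norm_wexp_le L hθ (hA ν) k
  lipschitz k ν μ i := by
    show ‖((lev L k : ℕ) : ℂ) • (uexp L θ (A ν) k - uexp L θ (A ν) k)‖ ≤ 0 / (lev L k : ℕ)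
    rw [sub_self, smul_zero, norm_zero, zero_div]

omit hM in
/-- **NOT THE FLAT BACKGROUND**: for `A_ν ≠ 0`, `‖A_ν‖ ≤ 1`, `0 < |θ| < 1` the transporters in direction `ν` differ from the identity.
[folklore] -/
theorem constRg_ne_one {A : Fin d → Matrix o o ℂ} {ν : Fin d} (hA0 : A ν ≠ 0) (hA : ‖A ν‖ ≤ 1) {θ : ℝ} (h0 : θ ≠ 0) (h1 : |θ| < 1)
    (k : ℕ) (x : Tor (fine (lev L k) M)) : constRg L M A θ k ν x ≠ 1 := by
  intro h
  apply wexp_ne_zero L h0 h1 hA0 hA k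
  show ((lev L k : ℕ) : ℂ) • (constRg L M A θ k ν x - 1) = 0
  rw [h, sub_self, smul_zero]

omit [NeZero L] hM in
/-- for skew-adjoint generators the transporters are unitary (Bałaban's setting has unitary colour transporters). [folklore] -/
theorem constRg_mem_unitary {A : Fin d → Matrix o o ℂ} {ν : Fin d} (hA : A ν ∈ skewAdjoint (Matrix o o ℂ)) (θ : ℝ) (k : ℕ)
    (x : Tor (fine (lev L k) M)) : constRg L M A θ k ν x ∈ unitary (Matrix o o ℂ) := by
  letI : NormedAlgebra ℚ (Matrix o o ℂ) := NormedAlgebra.restrictScalars ℚ ℂ (Matrix o o ℂ)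
  refine NormedSpace.exp_mem_unitary_of_mem_skewAdjoint ?_
  rw [skewAdjoint.mem_iff] at hA ⊢
  show star ((((θ / (lev L k : ℕ) : ℝ) : ℂ)) • A ν) = -((((θ / (lev L k : ℕ) : ℝ) : ℂ)) • A ν)
  rw [star_smul, hA, Complex.star_def, Complex.conj_ofReal, smul_neg]

/-! ## §3 Node NE3's hypothesis SHAPE holds for the family with rate `L^{−k}` -/

/-- **NODE NE3's HYPOTHESIS SHAPE ON THE CONSTANT EXPONENTIAL FAMILY** (`|θ| ≤ 1`, `‖A_ν‖ ≤ 1`): the readings of the class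
`{w, D_νw_ν} = {k ↦ w_k(θ, A_ν), 0}` are two-level consistent with constant `2θ²` and rate `L^{−1}`, i.e.
`LocalRate (bgReadings (regClass (liftR (constRg A θ)))) (2θ²) L⁻¹` — through the owner's faithful adapter `localRate_of_consistent` fed with
`norm_wexp_succ_sub_le`.  A statement about the SHAPE on this toy family ONLY; node NE3 for Bałaban's minimisers is OPEN and untouched. [folklore] -/
theorem localRate_const {A : Fin d → Matrix o o ℂ} (hA : ∀ ν, ‖A ν‖ ≤ 1) {θ : ℝ} (hθ : |θ| ≤ 1) :
    LocalRate (bgReadings L M (regClass L M (liftR L M (constRg L M A θ)))) (2 * θ ^ 2) ((L : ℝ)⁻¹) := by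
  refine localRate_of_consistent L M fun W hW k ν x' => ?_
  rcases hW with rfl | hW
  · show ‖wexp L θ (A ν) (k + 1) - wexp L θ (A ν) k‖ ≤ 2 * θ ^ 2 / (lev L k : ℕ)
    exact norm_wexp_succ_sub_le L hθ (hA ν) k
  · rw [Set.mem_singleton_iff] at hW
    subst hW
    rw [dconnTower_const, dconnTower_const, sub_self, norm_zero]
    have := lev_pos L k
    positivity

/-! ## §4 ROOT B's END on the family -/

omit [DecidableEq o] in
/-- the threshold is at most `½` (indeed `≤ 1/(2(d+1))`), so `|θ| + θ² ≤ η⋆` forces `|θ| ≤ ½`. [folklore] -/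
theorem etaStar_le_half {a' : ℝ} (ha' : 0 ≤ a') : etaStar o d a a' ≤ 1 / 2 := by
  have hKB4 : 0 ≤ KB4 d a' := by
    have := KS_nonneg (d := d) ha'; have := (K_nonneg (d := d) ha').2.1; unfold KB4; positivity
  have hd : (0 : ℝ) ≤ d := Nat.cast_nonneg d
  refine (min_le_left _ _).trans ?_
  exact one_div_le_one_div_of_le (by norm_num) (by nlinarith)

/-- **ROOT B's END ON THE CONSTANT EXPONENTIAL FAMILY, every other binder DISCHARGED** (`L ≥ 2`, `d ≥ 1`, `a′ > 0`, `‖A_ν‖ ≤ 1`,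
`|θ| + θ² ≤ η⋆(card o, d, a, a′)`): for the NON-FLAT background `constRg A θ` the lifted King-averaged unit-lattice covariances of
`(Δ_a^{(k)} ⊗ 1 + P_k(constRg A θ))⁻¹` — `P` the typed tier-B perturbation of ROOT B (covariant Laplacian + Bałaban's covariant line-sum
averaging + gauge term with site transports along the (1.7) legs) — CONVERGE with rate `L^{−k}`, by `NE2BalabanThreshold.balaban_final_rate_of_regular`
with `hreg := regularTransporters_const` (`α = |θ| + θ²`, `β = 0`), `hNE3 := localRate_const` (`C = 2θ²`), `η := η⋆`.  Shows the END's binder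
set is satisfiable by non-flat, non-abelian data; NOT a statement about Bałaban's minimisers; NE2 NOT proved. [folklore] -/
theorem balaban_final_rate_const (hL : 2 ≤ L) (hd : 1 ≤ d) {a' : ℝ} (ha' : 0 < a') {A : Fin d → Matrix o o ℂ}
    (hA : ∀ ν, ‖A ν‖ ≤ 1) {θ : ℝ} (hθ : |θ| + θ ^ 2 ≤ etaStar o d a a') :
    TowerLimitRate (fun k => Qlev L M k ⊗ₖ (1 : Matrix o o ℂ)) ((L : ℝ) ^ d)
      (fun k => (calDalev L M a ha k ⊗ₖ (1 : Matrix o o ℂ)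
        + balabanPert L M a (liftR L M (constRg L M A θ))
            (gaugeSlot L M (constRg L M A θ) (QuT L M o (siteT L M (constRg L M A θ))) (Q1 L M o) a') k)⁻¹)
      (Cpert (kappaBs o d a (|θ| + θ ^ 2) 0 (a * (epsR o d (|θ| + θ ^ 2) * (2 + epsR o d (|θ| + θ ^ 2)) * Cst d a))
          (kappa4F d a a' (|θ| + θ ^ 2) 0))
        (2 * d * Cst d a) (CJ d a)
        (C2Bs o d L a (|θ| + θ ^ 2) 0 (2 * θ ^ 2)
          (a * C2gram (Cst d a) 1 (epsR o d (|θ| + θ ^ 2)) (2 * d * Cst d a) (CJ d a) (Cst d a)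
            (CdeltaR o d a (|θ| + θ ^ 2) (theta0 d (|θ| + θ ^ 2) (betaNE3 o (2 * θ ^ 2)))))
          (C4F o d L a a' (|θ| + θ ^ 2) 0 (2 * θ ^ 2))) 0 1) ((L : ℝ)⁻¹) := by
  have hη := etaStar_pos (o := o) (d := d) a ha.le ha'.le
  have hθ1 : |θ| ≤ 1 := by
    have h := etaStar_le_half (o := o) (d := d) (a := a) ha'.le
    nlinarith [sq_nonneg θ, abs_nonneg θ]
  exact balaban_final_rate_of_regular L M a ha hL hd (regularTransporters_const L M hA hθ1) (by positivity)
    (localRate_const L M hA hθ1) ha' hθ hη.le le_rfl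

/-- **THE UNCONDITIONAL NON-FLAT INSTANCES** (`L ≥ 2`, `d ≥ 1`, `a′ > 0`, `‖A_ν‖ ≤ 1`): at `θ = η⋆/2` the condition `|θ| + θ² ≤ η⋆` holds, so
ROOT B's END fires for `constRg A (η⋆/2)` with NO hypothesis on `θ` left — for EVERY family of colour generators of norm `≤ 1`
(abelian phases `A_ν = i·1`, non-commuting skew-adjoint `A_μ, A_ν`, …).  NE2 NOT proved; nothing about `U_k(V)`. [folklore] -/
theorem balaban_final_rate_const_half (hL : 2 ≤ L) (hd : 1 ≤ d) {a' : ℝ} (ha' : 0 < a') {A : Fin d → Matrix o o ℂ}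
    (hA : ∀ ν, ‖A ν‖ ≤ 1) :
    let θ : ℝ := etaStar o d a a' / 2
    TowerLimitRate (fun k => Qlev L M k ⊗ₖ (1 : Matrix o o ℂ)) ((L : ℝ) ^ d)
      (fun k => (calDalev L M a ha k ⊗ₖ (1 : Matrix o o ℂ)
        + balabanPert L M a (liftR L M (constRg L M A θ))
            (gaugeSlot L M (constRg L M A θ) (QuT L M o (siteT L M (constRg L M A θ))) (Q1 L M o) a') k)⁻¹)
      (Cpert (kappaBs o d a (|θ| + θ ^ 2) 0 (a * (epsR o d (|θ| + θ ^ 2) * (2 + epsR o d (|θ| + θ ^ 2)) * Cst d a))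
          (kappa4F d a a' (|θ| + θ ^ 2) 0))
        (2 * d * Cst d a) (CJ d a)
        (C2Bs o d L a (|θ| + θ ^ 2) 0 (2 * θ ^ 2)
          (a * C2gram (Cst d a) 1 (epsR o d (|θ| + θ ^ 2)) (2 * d * Cst d a) (CJ d a) (Cst d a)
            (CdeltaR o d a (|θ| + θ ^ 2) (theta0 d (|θ| + θ ^ 2) (betaNE3 o (2 * θ ^ 2)))))
          (C4F o d L a a' (|θ| + θ ^ 2) 0 (2 * θ ^ 2))) 0 1) ((L : ℝ)⁻¹) := by
  intro θ
  have hη := etaStar_pos (o := o) (d := d) a ha.le ha'.le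
  have hη2 := etaStar_le_half (o := o) (d := d) (a := a) ha'.le
  have hθ : |θ| + θ ^ 2 ≤ etaStar o d a a' := by
    have hθ0 : (0 : ℝ) ≤ θ := by show (0 : ℝ) ≤ etaStar o d a a' / 2; linarith
    rw [abs_of_nonneg hθ0]
    show etaStar o d a a' / 2 + (etaStar o d a a' / 2) ^ 2 ≤ etaStar o d a a'
    nlinarith
  exact balaban_final_rate_const L M a ha hL hd ha' hA hθ

omit hM in
/-- and those instances ARE non-flat in every direction with `A_ν ≠ 0`. [folklore] -/
theorem constRg_half_ne_one (ha0 : 0 ≤ a) {a' : ℝ} (ha' : 0 ≤ a') {A : Fin d → Matrix o o ℂ} {ν : Fin d} (hA0 : A ν ≠ 0)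
    (hA : ‖A ν‖ ≤ 1) (k : ℕ) (x : Tor (fine (lev L k) M)) : constRg L M A (etaStar o d a a' / 2) k ν x ≠ 1 := by
  have hη := etaStar_pos (o := o) (d := d) a ha0 ha'
  have hη2 := etaStar_le_half (o := o) (d := d) (a := a) ha'
  refine constRg_ne_one L M hA0 hA (ne_of_gt (by linarith)) ?_ k x
  rw [abs_of_nonneg (by linarith)]
  linarith

end Summit.QuantumFields.BalabanUV.T4Continuum.NE2BalabanConstWitness

end
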